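import Mathlib
import Summits.PneNP.PneNP.Theorems.OverlapGapAlgebraSolvableImpliesStableSectionPeelingPathCount

/-!
# PneNP / OverlapGapAlgebra — crux `SolvableImpliesStableSection` (stmt-PneNP-2463):
# the MONOTONE REPAIR block (2/·) — closed clause-walks near a clause are rare

Support for crux `stmt-PneNP-2463` (`Summit.PneNP.PneNP.Theses.OverlapGapAlgebra.SolvableImpliesStableSection`):
the f-free block "bounded-round monotone repair gives stable sections up to `α ≤ 2^k/(4k)`".
The witness tree of a violated clause fails to be injective only if the clause starts a BAD WALK: an
injective clause sequence `c = w₀, w₁, …, w_L` in which consecutive clauses share a variable at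
prescribed slots (`var(w_{d+1}, u_{d+1}) = var(w_d, o_d)`), closed up by one more equation tying the
fresh slot `(w_L, o_L)` (`o_L ≠ u_L`) to another slot `(w_a, j)` (`a < L`, or `a = L` and `j ≠ o_L`).
This file counts them:

* `sissR_pathCount`, `sissR_pathCount_extra` — exact pattern counts (`#Inst / n^L`, resp.
  `#Inst / n^{L+1}` with the closing equation), generalising `sissP_pathCount(_extra)` to arbitrary
  in/out slots;
* `sissR_sum_card_badData_mul_le` — first moment of the bad-walk data of length `L`:
  `(∑_Φ #data) · n^{L+1} ≤ m^{L+1} k^{2L+3} (L+1) · #Inst`;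
* `sissR_card_badStart_le` — the clauses starting a bad walk of length `L` are at most the bad data.
Pure counting; no definitions; axioms `propext`, `Classical.choice`, `Quot.sound`.
-/

set_option linter.dupNamespace false -- `Summit.PneNP.PneNP.…`: summit = sub-problem (D-0017)

namespace Summit.PneNP.PneNP.Theorems

open Finset
open scoped Classical

section BadCount

variable {m k n : ℕ}

/-- **Exact count of an injective path pattern (general slots).** Let `c : ℕ → Fin m` be injective on
`[0, L]` and `u o : ℕ → Fin k` arbitrary. The instances in which, for every `d < L`, clause `c (d+1)`
carries at slot `u (d+1)` the variable of slot `o d` of clause `c d` number exactly `#Inst / n^L`. -/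
theorem sissR_pathCount (u o : ℕ → Fin k) :
    ∀ (L : ℕ) (c : ℕ → Fin m), (∀ a b, a ≤ L → b ≤ L → c a = c b → a = b) →
      ((univ : Finset (Fin m → Fin k → Fin n × Bool)).filter fun Φ =>
          ∀ d, d < L → (Φ (c (d + 1)) (u (d + 1))).1 = (Φ (c d) (o d)).1).card * n ^ L
        = Fintype.card (Fin m → Fin k → Fin n × Bool) := by
  intro L
  induction L with
  | zero =>
    intro c _
    simp
  | succ L ih =>
    intro c hinj
    have hinjL : ∀ a b, a ≤ L → b ≤ L → c a = c b → a = b :=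
      fun a b ha hb h => hinj a b (Nat.le_succ_of_le ha) (Nat.le_succ_of_le hb) h
    have hIH := ih c hinjL
    have hne : ∀ d, d ≤ L → c d ≠ c (L + 1) := by
      intro d hd h
      have := hinj d (L + 1) (Nat.le_succ_of_le hd) le_rfl h
      omega
    have hstep := sissP_card_filter_slot_mul (n := n) (c (L + 1)) (u (L + 1))
      (fun Φ => ∀ d, d < L → (Φ (c (d + 1)) (u (d + 1))).1 = (Φ (c d) (o d)).1)
      (fun Φ => (Φ (c L) (o L)).1) ?_ ?_
    rotate_left
    · intro Φ x
      refine forall_congr' fun d => forall_congr' fun hd => ?_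
      have h1 : c (d + 1) ≠ c (L + 1) := hne (d + 1) (by omega)
      have h2 : c d ≠ c (L + 1) := hne d (by omega)
      rw [Function.update_of_ne h1, Function.update_of_ne h2]
    · intro Φ x
      have h2 : c L ≠ c (L + 1) := hne L le_rfl
      simp only [Function.update_of_ne h2]
    have hsplit : ((univ : Finset (Fin m → Fin k → Fin n × Bool)).filter fun Φ =>
          ∀ d, d < L + 1 → (Φ (c (d + 1)) (u (d + 1))).1 = (Φ (c d) (o d)).1)
        = (univ : Finset (Fin m → Fin k → Fin n × Bool)).filter fun Φ =>
          (∀ d, d < L → (Φ (c (d + 1)) (u (d + 1))).1 = (Φ (c d) (o d)).1) ∧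
            (Φ (c (L + 1)) (u (L + 1))).1 = (Φ (c L) (o L)).1 := by
      refine Finset.filter_congr fun Φ _ => ⟨fun h => ⟨fun d hd => h d (by omega), h L (by omega)⟩,
        fun h d hd => ?_⟩
      rcases Nat.lt_succ_iff_lt_or_eq.1 hd with hd' | rfl
      · exact h.1 d hd'
      · exact h.2
    rw [hsplit, pow_succ, ← mul_assoc, mul_comm _ n, ← mul_assoc, mul_comm n, ← hIH]
    congr 1

/-- **Exact count of an injective path pattern with one closing equation.** As `sissR_pathCount`, plus
one more equation tying the FRESH slot `(c L, o L)` of the last clause (`o L ≠ u L` unless `L = 0`) to a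
different slot `(c a, j)` (`a < L`, or `a = L` and `j ≠ o L`):
`#{Φ : eqs ∧ var(c L, o L) = var(c a, j)} · n^{L+1} = #Inst`. -/
theorem sissR_pathCount_extra (u o : ℕ → Fin k) (L : ℕ) (c : ℕ → Fin m)
    (hinj : ∀ a b, a ≤ L → b ≤ L → c a = c b → a = b) (hfresh : L = 0 ∨ o L ≠ u L)
    (a : ℕ) (ha : a ≤ L) (j : Fin k) (haj : a < L ∨ j ≠ o L) :
    ((univ : Finset (Fin m → Fin k → Fin n × Bool)).filter fun Φ =>
        (∀ d, d < L → (Φ (c (d + 1)) (u (d + 1))).1 = (Φ (c d) (o d)).1) ∧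
          (Φ (c L) (o L)).1 = (Φ (c a) j).1).card * n ^ (L + 1)
      = Fintype.card (Fin m → Fin k → Fin n × Bool) := by
  have hne : ∀ d, d < L → c d ≠ c L := by
    intro d hd h
    have := hinj d L hd.le le_rfl h
    omega
  have hstep := sissP_card_filter_slot_mul (n := n) (c L) (o L)
    (fun Φ => ∀ d, d < L → (Φ (c (d + 1)) (u (d + 1))).1 = (Φ (c d) (o d)).1)
    (fun Φ => (Φ (c a) j).1) ?_ ?_
  rotate_left
  · intro Φ x
    refine forall_congr' fun d => forall_congr' fun hd => ?_
    have h2 : c d ≠ c L := hne d hd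
    rw [Function.update_of_ne h2]
    rcases Nat.lt_or_ge (d + 1) L with hd1 | hd1
    · rw [Function.update_of_ne (hne (d + 1) hd1)]
    · have hdL : d + 1 = L := by omega
      have hou : o L ≠ u L := by
        rcases hfresh with h0 | h0
        · omega
        · exact h0
      rw [hdL, Function.update_self, Function.update_of_ne hou.symm]
  · intro Φ x
    rcases Nat.lt_or_ge a L with haL | haL
    · simp only [Function.update_of_ne (hne a haL)]
    · have haL' : a = L := le_antisymm ha haL
      subst haL'
      have hjo : j ≠ o a := by
        rcases haj with h | h
        · exact absurd h (lt_irrefl _)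
        · exact h
      simp only [Function.update_self, Function.update_of_ne hjo]
  rw [pow_succ, ← mul_assoc, mul_comm _ n, ← mul_assoc, mul_comm n, ← sissR_pathCount u o L c hinj]
  congr 1

/-- **First moment of the bad-walk data.** For every length `L`, summing over the instance the number
of data `(w, u, o, a, j)` (clause sequence injective on `[0, L]`, in/out slots, closing slot) realising
the `L` path equations and the closing equation gives
`(∑_Φ #data) · n^{L+1} ≤ m^{L+1} k^{L+1} k^{L+1} ((L+1) k) · #Inst`. -/
theorem sissR_sum_card_badData_mul_le (L : ℕ) :
    (∑ Φ : Fin m → Fin k → Fin n × Bool,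
      ((univ : Finset ((Fin (L + 1) → Fin m) × (Fin (L + 1) → Fin k) × (Fin (L + 1) → Fin k) ×
        Fin (L + 1) × Fin k)).filter fun p =>
          (∀ a b, a ≤ L → b ≤ L → (fun e : ℕ => if h : e ≤ L then p.1 ⟨e, Nat.lt_succ_of_le h⟩ else p.1 0) a = (fun e : ℕ => if h : e ≤ L then p.1 ⟨e, Nat.lt_succ_of_le h⟩ else p.1 0) b → a = b) ∧
          (∀ d, d < L → (Φ ((fun e : ℕ => if h : e ≤ L then p.1 ⟨e, Nat.lt_succ_of_le h⟩ else p.1 0) (d + 1)) ((fun e : ℕ => if h : e ≤ L then p.2.1 ⟨e, Nat.lt_succ_of_le h⟩ else p.2.1 0) (d + 1))).1 =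
            (Φ ((fun e : ℕ => if h : e ≤ L then p.1 ⟨e, Nat.lt_succ_of_le h⟩ else p.1 0) d) ((fun e : ℕ => if h : e ≤ L then p.2.2.1 ⟨e, Nat.lt_succ_of_le h⟩ else p.2.2.1 0) d)).1) ∧
          (L = 0 ∨ (fun e : ℕ => if h : e ≤ L then p.2.2.1 ⟨e, Nat.lt_succ_of_le h⟩ else p.2.2.1 0) L ≠ (fun e : ℕ => if h : e ≤ L then p.2.1 ⟨e, Nat.lt_succ_of_le h⟩ else p.2.1 0) L) ∧
          ((p.2.2.2.1 : ℕ) < L ∨ p.2.2.2.2 ≠ (fun e : ℕ => if h : e ≤ L then p.2.2.1 ⟨e, Nat.lt_succ_of_le h⟩ else p.2.2.1 0) L) ∧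
          (Φ ((fun e : ℕ => if h : e ≤ L then p.1 ⟨e, Nat.lt_succ_of_le h⟩ else p.1 0) L) ((fun e : ℕ => if h : e ≤ L then p.2.2.1 ⟨e, Nat.lt_succ_of_le h⟩ else p.2.2.1 0) L)).1 = (Φ ((fun e : ℕ => if h : e ≤ L then p.1 ⟨e, Nat.lt_succ_of_le h⟩ else p.1 0) p.2.2.2.1) p.2.2.2.2).1).card)
        * n ^ (L + 1)
      ≤ m ^ (L + 1) * k ^ (L + 1) * k ^ (L + 1) * ((L + 1) * k) *
          Fintype.card (Fin m → Fin k → Fin n × Bool) := by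
  -- swap the sums
  rw [show (∑ Φ : Fin m → Fin k → Fin n × Bool,
      ((univ : Finset ((Fin (L + 1) → Fin m) × (Fin (L + 1) → Fin k) × (Fin (L + 1) → Fin k) ×
        Fin (L + 1) × Fin k)).filter fun p =>
          (∀ a b, a ≤ L → b ≤ L → (fun e : ℕ => if h : e ≤ L then p.1 ⟨e, Nat.lt_succ_of_le h⟩ else p.1 0) a = (fun e : ℕ => if h : e ≤ L then p.1 ⟨e, Nat.lt_succ_of_le h⟩ else p.1 0) b → a = b) ∧
          (∀ d, d < L → (Φ ((fun e : ℕ => if h : e ≤ L then p.1 ⟨e, Nat.lt_succ_of_le h⟩ else p.1 0) (d + 1)) ((fun e : ℕ => if h : e ≤ L then p.2.1 ⟨e, Nat.lt_succ_of_le h⟩ else p.2.1 0) (d + 1))).1 =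
            (Φ ((fun e : ℕ => if h : e ≤ L then p.1 ⟨e, Nat.lt_succ_of_le h⟩ else p.1 0) d) ((fun e : ℕ => if h : e ≤ L then p.2.2.1 ⟨e, Nat.lt_succ_of_le h⟩ else p.2.2.1 0) d)).1) ∧
          (L = 0 ∨ (fun e : ℕ => if h : e ≤ L then p.2.2.1 ⟨e, Nat.lt_succ_of_le h⟩ else p.2.2.1 0) L ≠ (fun e : ℕ => if h : e ≤ L then p.2.1 ⟨e, Nat.lt_succ_of_le h⟩ else p.2.1 0) L) ∧
          ((p.2.2.2.1 : ℕ) < L ∨ p.2.2.2.2 ≠ (fun e : ℕ => if h : e ≤ L then p.2.2.1 ⟨e, Nat.lt_succ_of_le h⟩ else p.2.2.1 0) L) ∧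
          (Φ ((fun e : ℕ => if h : e ≤ L then p.1 ⟨e, Nat.lt_succ_of_le h⟩ else p.1 0) L) ((fun e : ℕ => if h : e ≤ L then p.2.2.1 ⟨e, Nat.lt_succ_of_le h⟩ else p.2.2.1 0) L)).1 = (Φ ((fun e : ℕ => if h : e ≤ L then p.1 ⟨e, Nat.lt_succ_of_le h⟩ else p.1 0) p.2.2.2.1) p.2.2.2.2).1).card)
      = ∑ p : (Fin (L + 1) → Fin m) × (Fin (L + 1) → Fin k) × (Fin (L + 1) → Fin k) ×
          Fin (L + 1) × Fin k, ((univ : Finset (Fin m → Fin k → Fin n × Bool)).filter fun Φ =>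
          (∀ a b, a ≤ L → b ≤ L → (fun e : ℕ => if h : e ≤ L then p.1 ⟨e, Nat.lt_succ_of_le h⟩ else p.1 0) a = (fun e : ℕ => if h : e ≤ L then p.1 ⟨e, Nat.lt_succ_of_le h⟩ else p.1 0) b → a = b) ∧
          (∀ d, d < L → (Φ ((fun e : ℕ => if h : e ≤ L then p.1 ⟨e, Nat.lt_succ_of_le h⟩ else p.1 0) (d + 1)) ((fun e : ℕ => if h : e ≤ L then p.2.1 ⟨e, Nat.lt_succ_of_le h⟩ else p.2.1 0) (d + 1))).1 =
            (Φ ((fun e : ℕ => if h : e ≤ L then p.1 ⟨e, Nat.lt_succ_of_le h⟩ else p.1 0) d) ((fun e : ℕ => if h : e ≤ L then p.2.2.1 ⟨e, Nat.lt_succ_of_le h⟩ else p.2.2.1 0) d)).1) ∧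
          (L = 0 ∨ (fun e : ℕ => if h : e ≤ L then p.2.2.1 ⟨e, Nat.lt_succ_of_le h⟩ else p.2.2.1 0) L ≠ (fun e : ℕ => if h : e ≤ L then p.2.1 ⟨e, Nat.lt_succ_of_le h⟩ else p.2.1 0) L) ∧
          ((p.2.2.2.1 : ℕ) < L ∨ p.2.2.2.2 ≠ (fun e : ℕ => if h : e ≤ L then p.2.2.1 ⟨e, Nat.lt_succ_of_le h⟩ else p.2.2.1 0) L) ∧
          (Φ ((fun e : ℕ => if h : e ≤ L then p.1 ⟨e, Nat.lt_succ_of_le h⟩ else p.1 0) L) ((fun e : ℕ => if h : e ≤ L then p.2.2.1 ⟨e, Nat.lt_succ_of_le h⟩ else p.2.2.1 0) L)).1 = (Φ ((fun e : ℕ => if h : e ≤ L then p.1 ⟨e, Nat.lt_succ_of_le h⟩ else p.1 0) p.2.2.2.1) p.2.2.2.2).1).card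
      from by simp only [Finset.card_filter]; exact Finset.sum_comm]
  rw [Finset.sum_mul]
  -- each datum is realised by at most `#Inst / n^{L+1}` instances
  have hper : ∀ p : (Fin (L + 1) → Fin m) × (Fin (L + 1) → Fin k) × (Fin (L + 1) → Fin k) ×
      Fin (L + 1) × Fin k, ((univ : Finset (Fin m → Fin k → Fin n × Bool)).filter fun Φ =>
          (∀ a b, a ≤ L → b ≤ L → (fun e : ℕ => if h : e ≤ L then p.1 ⟨e, Nat.lt_succ_of_le h⟩ else p.1 0) a = (fun e : ℕ => if h : e ≤ L then p.1 ⟨e, Nat.lt_succ_of_le h⟩ else p.1 0) b → a = b) ∧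
          (∀ d, d < L → (Φ ((fun e : ℕ => if h : e ≤ L then p.1 ⟨e, Nat.lt_succ_of_le h⟩ else p.1 0) (d + 1)) ((fun e : ℕ => if h : e ≤ L then p.2.1 ⟨e, Nat.lt_succ_of_le h⟩ else p.2.1 0) (d + 1))).1 =
            (Φ ((fun e : ℕ => if h : e ≤ L then p.1 ⟨e, Nat.lt_succ_of_le h⟩ else p.1 0) d) ((fun e : ℕ => if h : e ≤ L then p.2.2.1 ⟨e, Nat.lt_succ_of_le h⟩ else p.2.2.1 0) d)).1) ∧
          (L = 0 ∨ (fun e : ℕ => if h : e ≤ L then p.2.2.1 ⟨e, Nat.lt_succ_of_le h⟩ else p.2.2.1 0) L ≠ (fun e : ℕ => if h : e ≤ L then p.2.1 ⟨e, Nat.lt_succ_of_le h⟩ else p.2.1 0) L) ∧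
          ((p.2.2.2.1 : ℕ) < L ∨ p.2.2.2.2 ≠ (fun e : ℕ => if h : e ≤ L then p.2.2.1 ⟨e, Nat.lt_succ_of_le h⟩ else p.2.2.1 0) L) ∧
          (Φ ((fun e : ℕ => if h : e ≤ L then p.1 ⟨e, Nat.lt_succ_of_le h⟩ else p.1 0) L) ((fun e : ℕ => if h : e ≤ L then p.2.2.1 ⟨e, Nat.lt_succ_of_le h⟩ else p.2.2.1 0) L)).1 = (Φ ((fun e : ℕ => if h : e ≤ L then p.1 ⟨e, Nat.lt_succ_of_le h⟩ else p.1 0) p.2.2.2.1) p.2.2.2.2).1).card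
        * n ^ (L + 1) ≤ Fintype.card (Fin m → Fin k → Fin n × Bool) := by
    intro p
    by_cases hI : (∀ a b, a ≤ L → b ≤ L → (fun e : ℕ => if h : e ≤ L then p.1 ⟨e, Nat.lt_succ_of_le h⟩ else p.1 0) a = (fun e : ℕ => if h : e ≤ L then p.1 ⟨e, Nat.lt_succ_of_le h⟩ else p.1 0) b → a = b) ∧
        (L = 0 ∨ (fun e : ℕ => if h : e ≤ L then p.2.2.1 ⟨e, Nat.lt_succ_of_le h⟩ else p.2.2.1 0) L ≠ (fun e : ℕ => if h : e ≤ L then p.2.1 ⟨e, Nat.lt_succ_of_le h⟩ else p.2.1 0) L) ∧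
        ((p.2.2.2.1 : ℕ) < L ∨ p.2.2.2.2 ≠ (fun e : ℕ => if h : e ≤ L then p.2.2.1 ⟨e, Nat.lt_succ_of_le h⟩ else p.2.2.1 0) L)
    · have hcount := sissR_pathCount_extra (n := n) ((fun e : ℕ => if h : e ≤ L then p.2.1 ⟨e, Nat.lt_succ_of_le h⟩ else p.2.1 0)) ((fun e : ℕ => if h : e ≤ L then p.2.2.1 ⟨e, Nat.lt_succ_of_le h⟩ else p.2.2.1 0)) L ((fun e : ℕ => if h : e ≤ L then p.1 ⟨e, Nat.lt_succ_of_le h⟩ else p.1 0))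
        hI.1 hI.2.1 p.2.2.2.1 (Nat.le_of_lt_succ p.2.2.2.1.isLt) p.2.2.2.2 hI.2.2
      rw [← hcount]
      refine Nat.mul_le_mul_right _ (Finset.card_le_card fun Φ hΦ => ?_)
      rw [Finset.mem_filter] at hΦ ⊢
      exact ⟨hΦ.1, hΦ.2.2.1, hΦ.2.2.2.2.2⟩
    · rw [Finset.filter_eq_empty_iff.2 fun Φ _ h => hI ⟨h.1, h.2.2.1, h.2.2.2.1⟩, Finset.card_empty,
        zero_mul]
      exact Nat.zero_le _
  refine (Finset.sum_le_sum fun p _ => hper p).trans ?_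
  rw [Finset.sum_const, smul_eq_mul, Finset.card_univ]
  simp only [Fintype.card_prod, Fintype.card_fun, Fintype.card_fin]
  exact le_of_eq (by ring)

/-- **Clauses starting a bad walk are at most the bad data.** For every instance `Φ` and length `L`,
the number of clauses `c` from which an injective clause sequence `w` (`w 0 = c`) with in/out slots
`u, o`, the `L` path equations and a closing equation starts is at most the number of bad data. -/
theorem sissR_card_badStart_le (Φ : Fin m → Fin k → Fin n × Bool) (L : ℕ) :
    ((univ : Finset (Fin m)).filter fun c => ∃ (w : ℕ → Fin m) (u o : ℕ → Fin k) (a : ℕ) (j : Fin k),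
        w 0 = c ∧ a ≤ L ∧ (∀ a' b', a' ≤ L → b' ≤ L → w a' = w b' → a' = b') ∧
        (∀ d, d < L → (Φ (w (d + 1)) (u (d + 1))).1 = (Φ (w d) (o d)).1) ∧
        (L = 0 ∨ o L ≠ u L) ∧ (a < L ∨ j ≠ o L) ∧ (Φ (w L) (o L)).1 = (Φ (w a) j).1).card
      ≤ ((univ : Finset ((Fin (L + 1) → Fin m) × (Fin (L + 1) → Fin k) × (Fin (L + 1) → Fin k) ×
        Fin (L + 1) × Fin k)).filter fun p =>
          (∀ a b, a ≤ L → b ≤ L → (fun e : ℕ => if h : e ≤ L then p.1 ⟨e, Nat.lt_succ_of_le h⟩ else p.1 0) a = (fun e : ℕ => if h : e ≤ L then p.1 ⟨e, Nat.lt_succ_of_le h⟩ else p.1 0) b → a = b) ∧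
          (∀ d, d < L → (Φ ((fun e : ℕ => if h : e ≤ L then p.1 ⟨e, Nat.lt_succ_of_le h⟩ else p.1 0) (d + 1)) ((fun e : ℕ => if h : e ≤ L then p.2.1 ⟨e, Nat.lt_succ_of_le h⟩ else p.2.1 0) (d + 1))).1 =
            (Φ ((fun e : ℕ => if h : e ≤ L then p.1 ⟨e, Nat.lt_succ_of_le h⟩ else p.1 0) d) ((fun e : ℕ => if h : e ≤ L then p.2.2.1 ⟨e, Nat.lt_succ_of_le h⟩ else p.2.2.1 0) d)).1) ∧
          (L = 0 ∨ (fun e : ℕ => if h : e ≤ L then p.2.2.1 ⟨e, Nat.lt_succ_of_le h⟩ else p.2.2.1 0) L ≠ (fun e : ℕ => if h : e ≤ L then p.2.1 ⟨e, Nat.lt_succ_of_le h⟩ else p.2.1 0) L) ∧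
          ((p.2.2.2.1 : ℕ) < L ∨ p.2.2.2.2 ≠ (fun e : ℕ => if h : e ≤ L then p.2.2.1 ⟨e, Nat.lt_succ_of_le h⟩ else p.2.2.1 0) L) ∧
          (Φ ((fun e : ℕ => if h : e ≤ L then p.1 ⟨e, Nat.lt_succ_of_le h⟩ else p.1 0) L) ((fun e : ℕ => if h : e ≤ L then p.2.2.1 ⟨e, Nat.lt_succ_of_le h⟩ else p.2.2.1 0) L)).1 = (Φ ((fun e : ℕ => if h : e ≤ L then p.1 ⟨e, Nat.lt_succ_of_le h⟩ else p.1 0) p.2.2.2.1) p.2.2.2.2).1).card := by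
  refine le_trans (Finset.card_le_card (t := (((univ : Finset ((Fin (L + 1) → Fin m) ×
      (Fin (L + 1) → Fin k) × (Fin (L + 1) → Fin k) × Fin (L + 1) × Fin k)).filter fun p =>
          (∀ a b, a ≤ L → b ≤ L → (fun e : ℕ => if h : e ≤ L then p.1 ⟨e, Nat.lt_succ_of_le h⟩ else p.1 0) a = (fun e : ℕ => if h : e ≤ L then p.1 ⟨e, Nat.lt_succ_of_le h⟩ else p.1 0) b → a = b) ∧
          (∀ d, d < L → (Φ ((fun e : ℕ => if h : e ≤ L then p.1 ⟨e, Nat.lt_succ_of_le h⟩ else p.1 0) (d + 1)) ((fun e : ℕ => if h : e ≤ L then p.2.1 ⟨e, Nat.lt_succ_of_le h⟩ else p.2.1 0) (d + 1))).1 =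
            (Φ ((fun e : ℕ => if h : e ≤ L then p.1 ⟨e, Nat.lt_succ_of_le h⟩ else p.1 0) d) ((fun e : ℕ => if h : e ≤ L then p.2.2.1 ⟨e, Nat.lt_succ_of_le h⟩ else p.2.2.1 0) d)).1) ∧
          (L = 0 ∨ (fun e : ℕ => if h : e ≤ L then p.2.2.1 ⟨e, Nat.lt_succ_of_le h⟩ else p.2.2.1 0) L ≠ (fun e : ℕ => if h : e ≤ L then p.2.1 ⟨e, Nat.lt_succ_of_le h⟩ else p.2.1 0) L) ∧
          ((p.2.2.2.1 : ℕ) < L ∨ p.2.2.2.2 ≠ (fun e : ℕ => if h : e ≤ L then p.2.2.1 ⟨e, Nat.lt_succ_of_le h⟩ else p.2.2.1 0) L) ∧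
          (Φ ((fun e : ℕ => if h : e ≤ L then p.1 ⟨e, Nat.lt_succ_of_le h⟩ else p.1 0) L) ((fun e : ℕ => if h : e ≤ L then p.2.2.1 ⟨e, Nat.lt_succ_of_le h⟩ else p.2.2.1 0) L)).1 = (Φ ((fun e : ℕ => if h : e ≤ L then p.1 ⟨e, Nat.lt_succ_of_le h⟩ else p.1 0) p.2.2.2.1) p.2.2.2.2).1).image
      (fun p => p.1 0))) ?_) Finset.card_image_le
  intro c hc
  rw [Finset.mem_filter] at hc
  obtain ⟨w, u, o, a, j, hw0, haL, hinj, hpath, hfresh, haj, hextra⟩ := hc.2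
  rw [Finset.mem_image]
  refine ⟨(fun e => w e, fun e => u e, fun e => o e, ⟨a, Nat.lt_succ_of_le haL⟩, j), ?_, ?_⟩
  · rw [Finset.mem_filter]
    have hW : ∀ e, e ≤ L → (fun e : ℕ => if h : e ≤ L then (fun e : Fin (L + 1) => w e) ⟨e, Nat.lt_succ_of_le h⟩ else (fun e : Fin (L + 1) => w e) 0) e = w e := fun e he => by
      show (if h : e ≤ L then (fun e : Fin (L + 1) => w e) ⟨e, Nat.lt_succ_of_le h⟩
        else (fun e : Fin (L + 1) => w e) 0) = w e
      rw [dif_pos he]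
    have hU : ∀ e, e ≤ L → (fun e : ℕ => if h : e ≤ L then (fun e : Fin (L + 1) => u e) ⟨e, Nat.lt_succ_of_le h⟩ else (fun e : Fin (L + 1) => u e) 0) e = u e := fun e he => by
      show (if h : e ≤ L then (fun e : Fin (L + 1) => u e) ⟨e, Nat.lt_succ_of_le h⟩
        else (fun e : Fin (L + 1) => u e) 0) = u e
      rw [dif_pos he]
    have hO : ∀ e, e ≤ L → (fun e : ℕ => if h : e ≤ L then (fun e : Fin (L + 1) => o e) ⟨e, Nat.lt_succ_of_le h⟩ else (fun e : Fin (L + 1) => o e) 0) e = o e := fun e he => by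
      show (if h : e ≤ L then (fun e : Fin (L + 1) => o e) ⟨e, Nat.lt_succ_of_le h⟩
        else (fun e : Fin (L + 1) => o e) 0) = o e
      rw [dif_pos he]
    refine ⟨mem_univ _, ?_, ?_, ?_, ?_, ?_⟩
    · intro a' b' ha' hb' h
      rw [hW a' ha', hW b' hb'] at h
      exact hinj a' b' ha' hb' h
    · intro d hd
      rw [hW (d + 1) (by omega), hU (d + 1) (by omega), hW d (by omega), hO d (by omega)]
      exact hpath d hd
    · rw [hO L le_rfl, hU L le_rfl]
      exact hfresh
    · rw [hO L le_rfl]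
      exact haj
    · rw [hW L le_rfl, hO L le_rfl, hW a haL]
      exact hextra
  · show w ((0 : Fin (L + 1)) : ℕ) = c
    exact hw0

end BadCount

end Summit.PneNP.PneNP.Theorems
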